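import Mathlib
import Literature.Computability.AlgebraicComplexity.OrbitClosureProofs
import Literature.Computability.AlgebraicComplexity.MatMulRankLowerBoundsProofs

/-!
# Border non-membership gives Łojasiewicz exponent `0` — stub `stub_lojZero` of line `Sketch`
(crux `CertWindowQP`, stmt-ValiantsHypothesis-5640)

If `n ≤ m` and the padded permanent `X₀₀^{m-n} per_n` is not in the orbit closure `Δ[det_m]`,
then the fibre system `Rep(n,m)` ("`per_n = det (A₀ + ∑ x_e A_e)` identically") satisfies a
Łojasiewicz inequality at infinity with exponent `0`: the squared coefficient distance
`∑_μ |coeff_μ det(A₀ + ∑ x_e A_e) - coeff_μ per_n|²` is bounded below by some `ε > 0` uniformly in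
the entries `a` of `A₀, A_e`.

Proof. Otherwise pick `a_k` with distance `→ 0`, i.e. `det(A^{(k)}(x)) → per_n` coefficientwise.
Homogenise: for an `x`-polynomial `p` of degree `≤ m` put
`H(p) = ∑_μ coeff_μ p · X_y^{m-|μ|} X^{ι μ}` (`y = (0,0)`, `ι` the block placement of the `n²`
variables among the `m²` matrix variables). Then `H(det A^{(k)}(x))` is the linear substitution
instance `det (X_y A₀ + ∑ X_{ι e} A_e)` of `det_m` (both agree where `X_y ≠ 0`; multiply by `X_y`
and use `MvPolynomial.funext`), hence lies in `End · det_m ⊆ Δ[det_m]`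
(`endOrbit_subset_orbitClosure_holds`); `H(per_n) = X_y^{m-n} per_n(X_ι)` is the padded
permanent; the coefficients of `H(p)` are fixed finite linear combinations of those of `p`, so
`H(det A^{(k)}(x)) → H(per_n)` coefficientwise; and `Δ[det_m]`, a common zero set of polynomials
in the coefficients, is closed under coefficientwise limits (`MvPolynomial.continuous_eval`).
Contradiction.
-/

noncomputable section

open scoped BigOperators
open MvPolynomial Filter Topology

namespace Summit.ValiantsHypothesis.ValiantsHypothesis.Theorems

open Literature.Computability.AlgebraicComplexity

section Generic

variable {τ : Type*} {m : ℕ}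

/-- Evaluation of the homogenisation `H(p) = ∑_μ coeff_μ p · X_y^{m-|μ|} · X^{ι μ}` of an
`x`-polynomial `p` of total degree `≤ m` at a point with `x_y ≠ 0`:
`H(p)(x) = x_y^m · p(x_ι / x_y)`. [folklore] -/
theorem lojZero_eval_homog (y : Fin m × Fin m) (ι : τ → Fin m × Fin m) (p : MvPolynomial τ ℂ)
    (hp : p.totalDegree ≤ m) (x : Fin m × Fin m → ℂ) (hx : x y ≠ 0) :
    eval x (∑ μ ∈ p.support, coeff μ p • (X y ^ (m - μ.degree) * rename ι (monomial μ 1))) =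
      x y ^ m * eval (fun t => x (ι t) / x y) p := by
  rw [map_sum, eval_eq, Finset.mul_sum]
  refine Finset.sum_congr rfl fun μ hμ => ?_
  have hdeg : μ.degree ≤ m := by
    have := le_totalDegree hμ
    rw [Finsupp.degree_apply]
    exact le_trans this hp
  rw [smul_eval, map_mul, map_pow, eval_X, eval_rename, eval_monomial, one_mul]
  simp only [Function.comp_def, div_pow, Finsupp.prod, Finset.prod_div_distrib,
    Finset.prod_pow_eq_pow_sum]
  rw [← Finsupp.degree_apply,
    show x y ^ m = x y ^ (m - μ.degree) * x y ^ μ.degree from by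
      rw [← pow_add, Nat.sub_add_cancel hdeg]]
  have hpow : x y ^ μ.degree ≠ 0 := pow_ne_zero _ hx
  field_simp

/-- An `m × m` matrix of affine-linear `x`-polynomials has determinant of total degree `≤ m`.
[folklore] -/
theorem lojZero_totalDegree_affDet_le [Fintype τ] (c : Fin m × Fin m → ℂ) (b : τ → Fin m × Fin m → ℂ) :
    (Matrix.det (Matrix.of fun i j : Fin m => C (c (i, j)) + ∑ t : τ, X t * C (b t (i, j)) :
      Matrix (Fin m) (Fin m) (MvPolynomial τ ℂ))).totalDegree ≤ m := by
  refine (totalDegree_det_le _ fun i j => ?_).trans (by simp)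
  rw [Matrix.of_apply]
  refine (totalDegree_add _ _).trans (max_le ?_ ?_)
  · rw [totalDegree_C]; exact Nat.zero_le _
  · refine totalDegree_finsetSum_le fun t _ => (totalDegree_mul _ _).trans ?_
    rw [totalDegree_X, totalDegree_C]

/-- **Homogenised affine pencils are linear substitution instances of `det_m`.** For concrete
matrices `A₀ = (c_{ij})`, `A_t = (b_{t,ij})`, the homogenisation
`H(det(A₀ + ∑ x_t A_t)) = ∑_μ coeff_μ det(A₀ + ∑ x_t A_t) · X_y^{m-|μ|} X^{ι μ}` is the value of
`det_m` under the linear substitution `X_{ij} ↦ c_{ij} X_y + ∑_t b_{t,ij} X_{ι t}`; in particular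
it lies in the endomorphism orbit of `det_m`. (Both sides agree at every point with `x_y ≠ 0`,
pulling `x_y` out of each row; multiply by `X_y` and compare as functions — `ℂ` is infinite.)
Mulmuley–Sohoni 2001 Prop. 4.4 (the exact-representation case is
`X_pow_mul_rename_mem_endOrbit_detPoly`). -/
theorem lojZero_homog_affDet_mem_endOrbit [Fintype τ] [DecidableEq τ] (y : Fin m × Fin m) (ι : τ → Fin m × Fin m)
    (c : Fin m × Fin m → ℂ) (b : τ → Fin m × Fin m → ℂ) :
    (∑ μ ∈ (Matrix.det (Matrix.of fun i j : Fin m => C (c (i, j)) + ∑ t : τ, X t * C (b t (i, j)) :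
        Matrix (Fin m) (Fin m) (MvPolynomial τ ℂ))).support,
      coeff μ (Matrix.det (Matrix.of fun i j : Fin m => C (c (i, j)) + ∑ t : τ, X t * C (b t (i, j)) :
        Matrix (Fin m) (Fin m) (MvPolynomial τ ℂ))) •
        (X y ^ (m - μ.degree) * rename ι (monomial μ 1))) ∈
      endOrbit (Fin m × Fin m) ℂ (detPoly (Fin m) ℂ) := by
  classical
  set A : Matrix (Fin m) (Fin m) (MvPolynomial τ ℂ) :=
    Matrix.of fun i j : Fin m => C (c (i, j)) + ∑ t : τ, X t * C (b t (i, j)) with hA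
  set H : MvPolynomial (Fin m × Fin m) ℂ :=
    ∑ μ ∈ A.det.support, coeff μ A.det • (X y ^ (m - μ.degree) * rename ι (monomial μ 1)) with hH
  -- the homogenising substitution matrix
  set M : Matrix (Fin m × Fin m) (Fin m × Fin m) ℂ := fun p ij =>
    (if p = y then c ij else 0) + ∑ t, if p = ι t then b t ij else 0 with hM
  refine ⟨M, ?_⟩
  -- values of the substituted entries where `x y ≠ 0`
  have hentry : ∀ (x : Fin m × Fin m → ℂ), x y ≠ 0 → ∀ i j : Fin m,
      eval x (linSubst _ ℂ M (X (i, j))) = x y * eval (fun t => x (ι t) / x y) (A i j) := by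
    intro x hx i j
    rw [linSubst_X, map_sum]
    simp only [smul_eval, eval_X, hM, add_mul, Finset.sum_add_distrib, Finset.sum_mul, ite_mul,
      zero_mul, hA, Matrix.of_apply, map_add, eval_C, map_sum, map_mul, eval_X]
    rw [Finset.sum_comm]
    simp only [mul_add, Finset.mul_sum]
    congr 1
    · rw [Finset.sum_ite_eq' Finset.univ y, if_pos (Finset.mem_univ _)]
      ring
    · refine Finset.sum_congr rfl fun t _ => ?_
      rw [Finset.sum_ite_eq' Finset.univ (ι t), if_pos (Finset.mem_univ _)]
      field_simp
  -- values of the substituted determinant where `x y ≠ 0`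
  have hdet : ∀ (x : Fin m × Fin m → ℂ), x y ≠ 0 →
      eval x (linSubst _ ℂ M (detPoly (Fin m) ℂ)) = x y ^ m * eval (fun t => x (ι t) / x y) A.det := by
    intro x hx
    have hmat : ((Matrix.mvPolynomialX (Fin m) (Fin m) ℂ).map (linSubst _ ℂ M)).map (eval x) =
        x y • A.map (eval fun t => x (ι t) / x y) := by
      ext i j
      simp only [Matrix.map_apply, Matrix.mvPolynomialX_apply, Matrix.smul_apply, smul_eq_mul]
      exact hentry x hx i j
    rw [detPoly, AlgHom.map_det, RingHom.map_det, AlgHom.mapMatrix_apply, RingHom.mapMatrix_apply,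
      hmat, Matrix.det_smul, Fintype.card_fin, ← RingHom.mapMatrix_apply, ← RingHom.map_det]
  -- the two polynomials agree where `x y ≠ 0`, hence everywhere
  have hdeg : A.det.totalDegree ≤ m := lojZero_totalDegree_affDet_le c b
  have hprod : (linSubst _ ℂ M (detPoly (Fin m) ℂ) - H) * X y = 0 := by
    apply MvPolynomial.funext
    intro x
    rw [map_mul, map_sub, map_zero, eval_X]
    by_cases hx : x y = 0
    · rw [hx, mul_zero]
    · rw [hdet x hx, hH, lojZero_eval_homog y ι A.det hdeg x hx, sub_self, zero_mul]
  have hX : (X y : MvPolynomial (Fin m × Fin m) ℂ) ≠ 0 := X_ne_zero y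
  exact (sub_eq_zero.mp ((mul_eq_zero.mp hprod).resolve_right hX))

/-- The homogenisation sum may be taken over any finite set of monomials containing the support.
[folklore] -/
theorem lojZero_homog_sum_subset (y : Fin m × Fin m) (ι : τ → Fin m × Fin m)
    {p : MvPolynomial τ ℂ} {S : Finset (τ →₀ ℕ)} (hS : p.support ⊆ S) :
    ∑ μ ∈ S, coeff μ p • ((X y : MvPolynomial (Fin m × Fin m) ℂ) ^ (m - μ.degree) *
        rename ι (monomial μ (1 : ℂ))) =
      ∑ μ ∈ p.support, coeff μ p • ((X y : MvPolynomial (Fin m × Fin m) ℂ) ^ (m - μ.degree) *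
        rename ι (monomial μ (1 : ℂ))) := by
  symm
  refine Finset.sum_subset hS fun μ _ hμ => ?_
  rw [notMem_support_iff.mp hμ, zero_smul]

/-- Coefficients of the homogenisation are fixed finite linear combinations of the coefficients.
[folklore] -/
theorem lojZero_coeff_homog (y : Fin m × Fin m) (ι : τ → Fin m × Fin m) (p : MvPolynomial τ ℂ)
    (S : Finset (τ →₀ ℕ)) (ν : (Fin m × Fin m) →₀ ℕ) :
    coeff ν (∑ μ ∈ S, coeff μ p • ((X y : MvPolynomial (Fin m × Fin m) ℂ) ^ (m - μ.degree) *
        rename ι (monomial μ (1 : ℂ)))) =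
      ∑ μ ∈ S, coeff μ p * coeff ν ((X y : MvPolynomial (Fin m × Fin m) ℂ) ^ (m - μ.degree) *
        rename ι (monomial μ (1 : ℂ))) := by
  rw [coeff_sum]
  simp only [coeff_smul, smul_eq_mul]

/-- **Orbit closures are closed under coefficientwise limits** (over `ℂ`): `Δ[f]` is the common
zero set, in coefficient space, of the polynomials vanishing on `GL · f`, and polynomial functions
are continuous for the product topology. Mulmuley–Sohoni 2001 §4.1. -/
theorem lojZero_mem_orbitClosure_of_tendsto {f g : MvPolynomial (Fin m × Fin m) ℂ}
    {gs : ℕ → MvPolynomial (Fin m × Fin m) ℂ} (hgs : ∀ k, gs k ∈ orbitClosure f)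
    (hlim : ∀ ν, Tendsto (fun k => coeff ν (gs k)) atTop (𝓝 (coeff ν g))) :
    g ∈ orbitClosure f := by
  rw [mem_orbitClosure_iff]
  intro p hp
  have hk : ∀ k, aeval (coeffVec (gs k)) p = 0 := fun k => (mem_orbitClosure_iff.mp (hgs k)) p hp
  have hvec : Tendsto (fun k => coeffVec (gs k)) atTop (𝓝 (coeffVec g)) :=
    tendsto_pi_nhds.mpr fun ν => hlim ν
  have hcont : Continuous fun c : ((Fin m × Fin m) →₀ ℕ) → ℂ => aeval c p :=
    MvPolynomial.continuous_eval p
  have h1 : Tendsto (fun k => aeval (coeffVec (gs k)) p) atTop (𝓝 (aeval (coeffVec g) p)) :=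
    (hcont.tendsto _).comp hvec
  simp only [hk] at h1
  exact (tendsto_nhds_unique tendsto_const_nhds h1).symm

end Generic

section Specific

/-! ### The concrete system `Rep(n,m)` -/

/-- Specialising the unknowns of the generic pencil determinant at a point `a` gives the concrete
affine determinant `det (A₀(a) + ∑ x_t A_t(a))`. [folklore] -/
theorem lojZero_map_eval_pencilDet (n m : ℕ) (a : Option (Fin n × Fin n) × (Fin m × Fin m) → ℂ) :
    MvPolynomial.map (MvPolynomial.eval a) (Matrix.det (Matrix.of fun i j : Fin m =>
        MvPolynomial.C (MvPolynomial.X (none, (i, j))) +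
          ∑ e : Fin n × Fin n, MvPolynomial.X e * MvPolynomial.C (MvPolynomial.X (some e, (i, j))) :
        Matrix (Fin m) (Fin m) (MvPolynomial (Fin n × Fin n)
          (MvPolynomial (Option (Fin n × Fin n) × (Fin m × Fin m)) ℂ)))) =
      Matrix.det (Matrix.of fun i j : Fin m =>
        C (a (none, (i, j))) + ∑ t : Fin n × Fin n, X t * C (a (some t, (i, j))) :
        Matrix (Fin m) (Fin m) (MvPolynomial (Fin n × Fin n) ℂ)) := by
  rw [RingHom.map_det, RingHom.mapMatrix_apply]
  congr 1
  ext i j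
  simp only [Matrix.map_apply, Matrix.of_apply, map_add, map_sum, map_mul, map_X, map_C, eval_X]

/-- The axioms of `Rep(n,m)` evaluated at a point `a` of unknown-space are the coefficient
differences `coeff_μ det(A(a)(x)) - coeff_μ per_n`. [folklore] -/
theorem lojZero_eval_coeff_defect (n m : ℕ) (a : Option (Fin n × Fin n) × (Fin m × Fin m) → ℂ)
    (μ : (Fin n × Fin n) →₀ ℕ) :
    MvPolynomial.eval a (((Matrix.det (Matrix.of fun i j : Fin m =>
        MvPolynomial.C (MvPolynomial.X (none, (i, j))) +
          ∑ e : Fin n × Fin n, MvPolynomial.X e * MvPolynomial.C (MvPolynomial.X (some e, (i, j))) :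
        Matrix (Fin m) (Fin m) (MvPolynomial (Fin n × Fin n)
          (MvPolynomial (Option (Fin n × Fin n) × (Fin m × Fin m)) ℂ)))) -
        MvPolynomial.map MvPolynomial.C (perPoly (Fin n) ℂ)).coeff μ) =
      coeff μ (Matrix.det (Matrix.of fun i j : Fin m =>
        C (a (none, (i, j))) + ∑ t : Fin n × Fin n, X t * C (a (some t, (i, j))) :
        Matrix (Fin m) (Fin m) (MvPolynomial (Fin n × Fin n) ℂ))) - coeff μ (perPoly (Fin n) ℂ) := by
  have hC : (MvPolynomial.eval a).comp
      (MvPolynomial.C : ℂ →+* MvPolynomial (Option (Fin n × Fin n) × (Fin m × Fin m)) ℂ) =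
      RingHom.id ℂ := RingHom.ext fun c => eval_C c
  rw [← coeff_map, map_sub, lojZero_map_eval_pencilDet, MvPolynomial.map_map, hC,
    MvPolynomial.map_id, coeff_sub]

/-- The homogenisation of `per_n` along the block placement is the padded permanent
`X₀₀^{m-n} · per_n(X_ι)`. [folklore] -/
theorem lojZero_homog_perPoly {n m : ℕ} [NeZero m] (e : Fin n ≃ BlockIdx n m) :
    ∑ μ ∈ (perPoly (Fin n) ℂ).support, coeff μ (perPoly (Fin n) ℂ) •
        ((X ((0 : Fin m), (0 : Fin m)) : MvPolynomial (Fin m × Fin m) ℂ) ^ (m - μ.degree) *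
          rename ((fun ij : BlockIdx n m × BlockIdx n m => ((ij.1 : Fin m), (ij.2 : Fin m))) ∘
            Prod.map e e) (monomial μ (1 : ℂ))) =
      paddedPerPoly ℂ n m := by
  have hper : perPoly (BlockIdx n m) ℂ = rename (Prod.map e e) (perPoly (Fin n) ℂ) :=
    (rename_perPoly_equiv e).symm
  rw [paddedPerPoly, hper, rename_rename]
  have hhom : (perPoly (Fin n) ℂ).IsHomogeneous n := by
    simpa using (perPoly_isHomogeneous (n := Fin n) (k := ℂ))
  have hdeg : ∀ μ ∈ (perPoly (Fin n) ℂ).support, μ.degree = n := fun μ hμ => by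
    rw [Finsupp.degree_eq_weight_one]
    exact hhom (mem_support_iff.mp hμ)
  calc _ = ∑ μ ∈ (perPoly (Fin n) ℂ).support,
        (X ((0 : Fin m), (0 : Fin m)) : MvPolynomial (Fin m × Fin m) ℂ) ^ (m - n) *
          rename ((fun ij : BlockIdx n m × BlockIdx n m => ((ij.1 : Fin m), (ij.2 : Fin m))) ∘
            Prod.map e e) (monomial μ (coeff μ (perPoly (Fin n) ℂ))) := by
        refine Finset.sum_congr rfl fun μ hμ => ?_
        rw [hdeg μ hμ, ← mul_smul_comm, ← map_smul, smul_monomial, smul_eq_mul, mul_one]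
    _ = _ := by
        rw [← Finset.mul_sum, ← map_sum, ← (perPoly (Fin n) ℂ).as_sum]

/-- The concrete affine determinants are supported on the monomials of the generic pencil
determinant. [folklore] -/
theorem lojZero_support_affDet_subset (n m : ℕ)
    (a : Option (Fin n × Fin n) × (Fin m × Fin m) → ℂ) :
    (Matrix.det (Matrix.of fun i j : Fin m =>
        C (a (none, (i, j))) + ∑ t : Fin n × Fin n, X t * C (a (some t, (i, j))) :
        Matrix (Fin m) (Fin m) (MvPolynomial (Fin n × Fin n) ℂ))).support ⊆ (Matrix.det (Matrix.of fun i j : Fin m =>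
        MvPolynomial.C (MvPolynomial.X (none, (i, j))) +
          ∑ e : Fin n × Fin n, MvPolynomial.X e * MvPolynomial.C (MvPolynomial.X (some e, (i, j))) :
        Matrix (Fin m) (Fin m) (MvPolynomial (Fin n × Fin n)
          (MvPolynomial (Option (Fin n × Fin n) × (Fin m × Fin m)) ℂ)))).support := by
  have h := support_map_subset (MvPolynomial.eval a) (Matrix.det (Matrix.of fun i j : Fin m =>
        MvPolynomial.C (MvPolynomial.X (none, (i, j))) +
          ∑ e : Fin n × Fin n, MvPolynomial.X e * MvPolynomial.C (MvPolynomial.X (some e, (i, j))) :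
        Matrix (Fin m) (Fin m) (MvPolynomial (Fin n × Fin n)
          (MvPolynomial (Option (Fin n × Fin n) × (Fin m × Fin m)) ℂ))))
  rwa [lojZero_map_eval_pencilDet] at h

/-- A single squared coefficient defect is bounded by the total squared defect (the term is `0`
off the support). [folklore] -/
theorem lojZero_term_le_sum {σ κ : Type*} (P : MvPolynomial κ (MvPolynomial σ ℂ)) (b : σ → ℂ)
    (μ : κ →₀ ℕ) :
    ‖MvPolynomial.eval b (P.coeff μ)‖ ^ 2 ≤ ∑ ν ∈ P.support, ‖MvPolynomial.eval b (P.coeff ν)‖ ^ 2 := by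
  by_cases hμ : μ ∈ P.support
  · exact Finset.single_le_sum (f := fun ν => ‖MvPolynomial.eval b (P.coeff ν)‖ ^ 2)
      (fun ν _ => by positivity) hμ
  · rw [notMem_support_iff.mp hμ, map_zero, norm_zero, zero_pow two_ne_zero]
    exact Finset.sum_nonneg fun ν _ => by positivity

/-- A sequence of complex numbers whose squared norms are dominated by a sequence tending to `0`
tends to `0`. [folklore] -/
theorem lojZero_tendsto_zero_of_sq_le {u : ℕ → ℂ} {F : ℕ → ℝ} (hle : ∀ k, ‖u k‖ ^ 2 ≤ F k)
    (hF : Tendsto F atTop (𝓝 0)) : Tendsto u atTop (𝓝 0) := by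
  have h2 : Tendsto (fun k => ‖u k‖ ^ 2) atTop (𝓝 0) :=
    squeeze_zero (fun k => by positivity) hle hF
  rw [tendsto_zero_iff_norm_tendsto_zero]
  simpa [Real.sqrt_sq (norm_nonneg _)] using h2.sqrt

/-- If the defect of `Rep(n,m)` at the points `a_k` tends to `0`, then
`det(A^{(k)}(x)) → per_n` coefficientwise. [folklore] -/
theorem lojZero_tendsto_coeff_affDet (n m : ℕ)
    (a : ℕ → Option (Fin n × Fin n) × (Fin m × Fin m) → ℂ)
    (hF : Tendsto (fun k => ∑ μ ∈ ((Matrix.det (Matrix.of fun i j : Fin m =>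
        MvPolynomial.C (MvPolynomial.X (none, (i, j))) +
          ∑ e : Fin n × Fin n, MvPolynomial.X e * MvPolynomial.C (MvPolynomial.X (some e, (i, j))) :
        Matrix (Fin m) (Fin m) (MvPolynomial (Fin n × Fin n)
          (MvPolynomial (Option (Fin n × Fin n) × (Fin m × Fin m)) ℂ)))) -
        MvPolynomial.map MvPolynomial.C (perPoly (Fin n) ℂ)).support,
      ‖MvPolynomial.eval (a k) (((Matrix.det (Matrix.of fun i j : Fin m =>
        MvPolynomial.C (MvPolynomial.X (none, (i, j))) +
          ∑ e : Fin n × Fin n, MvPolynomial.X e * MvPolynomial.C (MvPolynomial.X (some e, (i, j))) :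
        Matrix (Fin m) (Fin m) (MvPolynomial (Fin n × Fin n)
          (MvPolynomial (Option (Fin n × Fin n) × (Fin m × Fin m)) ℂ)))) -
        MvPolynomial.map MvPolynomial.C (perPoly (Fin n) ℂ)).coeff μ)‖ ^ 2) atTop (𝓝 0))
    (μ : (Fin n × Fin n) →₀ ℕ) :
    Tendsto (fun k => coeff μ (Matrix.det (Matrix.of fun i j : Fin m =>
        C (a k (none, (i, j))) + ∑ t : Fin n × Fin n, X t * C (a k (some t, (i, j))) :
        Matrix (Fin m) (Fin m) (MvPolynomial (Fin n × Fin n) ℂ)))) atTop (𝓝 (coeff μ (perPoly (Fin n) ℂ))) := by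
  have h : Tendsto (fun k => MvPolynomial.eval (a k) (((Matrix.det (Matrix.of fun i j : Fin m =>
        MvPolynomial.C (MvPolynomial.X (none, (i, j))) +
          ∑ e : Fin n × Fin n, MvPolynomial.X e * MvPolynomial.C (MvPolynomial.X (some e, (i, j))) :
        Matrix (Fin m) (Fin m) (MvPolynomial (Fin n × Fin n)
          (MvPolynomial (Option (Fin n × Fin n) × (Fin m × Fin m)) ℂ)))) -
      MvPolynomial.map MvPolynomial.C (perPoly (Fin n) ℂ)).coeff μ)) atTop (𝓝 0) :=
    lojZero_tendsto_zero_of_sq_le (fun k => lojZero_term_le_sum _ (a k) μ) hF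
  simp only [lojZero_eval_coeff_defect n m] at h
  exact tendsto_sub_nhds_zero_iff.mp h

/-- If `det(A^{(k)}(x)) → per_n` coefficientwise for some sequence of size-`m` affine pencils,
`n ≤ m`, then the padded permanent lies in `Δ[det_m]`. [folklore] -/
theorem lojZero_paddedPerPoly_mem_of_tendsto (n m : ℕ) [NeZero m] (hnm : n ≤ m)
    (a : ℕ → Option (Fin n × Fin n) × (Fin m × Fin m) → ℂ)
    (hcoeff : ∀ μ, Tendsto (fun k => coeff μ (Matrix.det (Matrix.of fun i j : Fin m =>
        C (a k (none, (i, j))) + ∑ t : Fin n × Fin n, X t * C (a k (some t, (i, j))) :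
        Matrix (Fin m) (Fin m) (MvPolynomial (Fin n × Fin n) ℂ)))) atTop
      (𝓝 (coeff μ (perPoly (Fin n) ℂ)))) :
    paddedPerPoly ℂ n m ∈ orbitClosure (detPoly (Fin m) ℂ) := by
  classical
  obtain ⟨e⟩ : Nonempty (Fin n ≃ BlockIdx n m) :=
    ⟨(Fintype.equivFinOfCardEq (card_blockIdx hnm)).symm⟩
  let ι : Fin n × Fin n → Fin m × Fin m :=
    (fun ij : BlockIdx n m × BlockIdx n m => ((ij.1 : Fin m), (ij.2 : Fin m))) ∘ Prod.map e e
  let S : Finset ((Fin n × Fin n) →₀ ℕ) := (Matrix.det (Matrix.of fun i j : Fin m =>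
        MvPolynomial.C (MvPolynomial.X (none, (i, j))) +
          ∑ e : Fin n × Fin n, MvPolynomial.X e * MvPolynomial.C (MvPolynomial.X (some e, (i, j))) :
        Matrix (Fin m) (Fin m) (MvPolynomial (Fin n × Fin n)
          (MvPolynomial (Option (Fin n × Fin n) × (Fin m × Fin m)) ℂ)))).support ∪ (perPoly (Fin n) ℂ).support
  have hsupp : ∀ k, (Matrix.det (Matrix.of fun i j : Fin m =>
        C (a k (none, (i, j))) + ∑ t : Fin n × Fin n, X t * C (a k (some t, (i, j))) :
        Matrix (Fin m) (Fin m) (MvPolynomial (Fin n × Fin n) ℂ))).support ⊆ S := fun k =>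
    (lojZero_support_affDet_subset n m (a k)).trans Finset.subset_union_left
  -- (1) the homogenised concrete determinants lie in the orbit closure
  have hgmem : ∀ k, (∑ μ ∈ S, coeff μ (Matrix.det (Matrix.of fun i j : Fin m =>
        C (a k (none, (i, j))) + ∑ t : Fin n × Fin n, X t * C (a k (some t, (i, j))) :
        Matrix (Fin m) (Fin m) (MvPolynomial (Fin n × Fin n) ℂ))) •
      ((X ((0 : Fin m), (0 : Fin m)) : MvPolynomial (Fin m × Fin m) ℂ) ^ (m - μ.degree) *
        rename ι (monomial μ (1 : ℂ)))) ∈ orbitClosure (detPoly (Fin m) ℂ) := fun k => by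
    rw [lojZero_homog_sum_subset _ ι (hsupp k)]
    exact endOrbit_subset_orbitClosure_holds _
      (lojZero_homog_affDet_mem_endOrbit _ ι (fun ij => a k (none, ij)) (fun t ij => a k (some t, ij)))
  -- (2) they converge coefficientwise to the homogenisation of `per_n`
  have hlim : ∀ ν, Tendsto (fun k => coeff ν (∑ μ ∈ S, coeff μ (Matrix.det (Matrix.of fun i j : Fin m =>
        C (a k (none, (i, j))) + ∑ t : Fin n × Fin n, X t * C (a k (some t, (i, j))) :
        Matrix (Fin m) (Fin m) (MvPolynomial (Fin n × Fin n) ℂ))) •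
      ((X ((0 : Fin m), (0 : Fin m)) : MvPolynomial (Fin m × Fin m) ℂ) ^ (m - μ.degree) *
        rename ι (monomial μ (1 : ℂ))))) atTop
      (𝓝 (coeff ν (∑ μ ∈ S, coeff μ (perPoly (Fin n) ℂ) •
        ((X ((0 : Fin m), (0 : Fin m)) : MvPolynomial (Fin m × Fin m) ℂ) ^ (m - μ.degree) *
          rename ι (monomial μ (1 : ℂ)))))) := fun ν => by
    simp only [lojZero_coeff_homog]
    exact tendsto_finsetSum _ fun μ _ => (hcoeff μ).mul_const _
  -- (3) the orbit closure is closed under such limits, and the limit is the padded permanent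
  have hmem := lojZero_mem_orbitClosure_of_tendsto hgmem hlim
  have hfin : ∑ μ ∈ (perPoly (Fin n) ℂ).support, coeff μ (perPoly (Fin n) ℂ) •
      ((X ((0 : Fin m), (0 : Fin m)) : MvPolynomial (Fin m × Fin m) ℂ) ^ (m - μ.degree) *
        rename ι (monomial μ (1 : ℂ))) = paddedPerPoly ℂ n m := lojZero_homog_perPoly e
  rwa [lojZero_homog_sum_subset _ ι Finset.subset_union_right, hfin] at hmem

/-- **Stub `stub_lojZero` of line `Sketch` (crux `CertWindowQP`).** If `n ≤ m` and the padded
permanent `X₀₀^{m-n} per_n` is not in `Δ[det_m]`, then `per_n` has positive coefficient distance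
from every size-`m` affine determinantal expression: there is `ε > 0` with
`∑_{μ ∈ supp P} |eqn_μ(a)|² ≥ ε` for every point `a` of unknown-space (a Łojasiewicz inequality
at infinity with exponent `0` for the fibre system `Rep(n,m)`). Proof: module docstring. -/
theorem certWindowQP_lojZero (n m : ℕ) [NeZero m] (hnm : n ≤ m)
    (hpad : paddedPerPoly ℂ n m ∉ orbitClosure (detPoly (Fin m) ℂ)) :
    ∃ ε : ℝ, 0 < ε ∧ ∀ a : Option (Fin n × Fin n) × (Fin m × Fin m) → ℂ,
      ε ≤ ∑ μ ∈ ((Matrix.of fun i j : Fin m => MvPolynomial.C (MvPolynomial.X (none, (i, j))) + ∑ e : Fin n × Fin n, MvPolynomial.X e * MvPolynomial.C (MvPolynomial.X (some e, (i, j))) : Matrix (Fin m) (Fin m) (MvPolynomial (Fin n × Fin n) (MvPolynomial (Option (Fin n × Fin n) × (Fin m × Fin m)) ℂ))).det - MvPolynomial.map MvPolynomial.C (Literature.Computability.AlgebraicComplexity.perPoly (Fin n) ℂ)).support,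
        ‖MvPolynomial.eval a (((Matrix.of fun i j : Fin m => MvPolynomial.C (MvPolynomial.X (none, (i, j))) + ∑ e : Fin n × Fin n, MvPolynomial.X e * MvPolynomial.C (MvPolynomial.X (some e, (i, j))) : Matrix (Fin m) (Fin m) (MvPolynomial (Fin n × Fin n) (MvPolynomial (Option (Fin n × Fin n) × (Fin m × Fin m)) ℂ))).det - MvPolynomial.map MvPolynomial.C (Literature.Computability.AlgebraicComplexity.perPoly (Fin n) ℂ)).coeff μ)‖ ^ 2 := by
  by_contra hcon
  push Not at hcon
  -- a sequence of points with defect `< 1/(k+1)`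
  choose a ha using fun k : ℕ => hcon (1 / ((k : ℝ) + 1)) (by positivity)
  refine hpad (lojZero_paddedPerPoly_mem_of_tendsto n m hnm a (lojZero_tendsto_coeff_affDet n m a ?_))
  exact squeeze_zero (fun k => Finset.sum_nonneg fun μ _ => by positivity) (fun k => (ha k).le)
    tendsto_one_div_add_atTop_nhds_zero_nat

end Specific

/-- **Registered stub `stub_lojZero`** of line `Sketch` (crux `CertWindowQP`, stmt-ValiantsHypothesis-5640),
verbatim signature of the registered skeleton `Cruxes/CertWindowQP/Lines/Sketch.lean`; proved by the
theorem above. -/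
theorem stub_lojZero (n m : ℕ) [NeZero m] (hnm : n ≤ m)
    (hpad : paddedPerPoly ℂ n m ∉ orbitClosure (detPoly (Fin m) ℂ)) :
    ∃ ε : ℝ, 0 < ε ∧ ∀ a : Option (Fin n × Fin n) × (Fin m × Fin m) → ℂ,
      ε ≤ ∑ μ ∈ ((Matrix.of fun i j : Fin m => MvPolynomial.C (MvPolynomial.X (none, (i, j))) + ∑ e : Fin n × Fin n, MvPolynomial.X e * MvPolynomial.C (MvPolynomial.X (some e, (i, j))) : Matrix (Fin m) (Fin m) (MvPolynomial (Fin n × Fin n) (MvPolynomial (Option (Fin n × Fin n) × (Fin m × Fin m)) ℂ))).det - MvPolynomial.map MvPolynomial.C (Literature.Computability.AlgebraicComplexity.perPoly (Fin n) ℂ)).support,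
        ‖MvPolynomial.eval a (((Matrix.of fun i j : Fin m => MvPolynomial.C (MvPolynomial.X (none, (i, j))) + ∑ e : Fin n × Fin n, MvPolynomial.X e * MvPolynomial.C (MvPolynomial.X (some e, (i, j))) : Matrix (Fin m) (Fin m) (MvPolynomial (Fin n × Fin n) (MvPolynomial (Option (Fin n × Fin n) × (Fin m × Fin m)) ℂ))).det - MvPolynomial.map MvPolynomial.C (Literature.Computability.AlgebraicComplexity.perPoly (Fin n) ℂ)).coeff μ)‖ ^ 2 :=
  certWindowQP_lojZero n m hnm hpad

end Summit.ValiantsHypothesis.ValiantsHypothesis.Theorems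

end
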